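import Mathlib.MeasureTheory.Integral.Average
import Literature.Claims.NS.Kyritsis2022
import Literature.Analysis.FluidPDE.VorticityStretching
import HarnessLib

/-!
# Solo salvage for claim C03 `Kyritsis2022` (cell `ns-claims`, D-0090): the TRUE steps before the
# first failing one, kernel-discharged

Claim skeleton: `Literature/Claims/NS/Kyritsis2022.lean` (typist `ns-claims-typist-3`, p457428 /
p457802). Adjudication (refuter-1, referee-1, filed by salvage-p4 under convention (b)): first
failing load-bearing step = `Step_6` (Lemma 4.2 in its printed generality, print p. 2550), class
false lemma; downstream `Step_10`, `Step_11` (`Theorem44Infinite`). This file is the SALVAGE side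
(seat `ns-claims-salvage-p3`): it proves, in the kernel, the steps of the skeleton that precede the
failing one and are true, so that the verdict's per-step table (TYPING-HYGIENE 11) can read
«kernel-discharged» instead of «plausible»:

* `step3_holds : Step_3` — Remark 2.1, p. 2541: a smooth Clay datum with the decay (2.4) has bounded
  vorticity (`sup ‖curl u₀‖ < ∞`): decay with `|α| = 1`, `K = 0` bounds `‖Du₀‖`, and
  `‖curl v(x)‖ ≤ ‖curlCLM‖ ‖Dv(x)‖` (tree `norm_curl_le`). Classical; no source needed beyond
  Fefferman's (4).
* `step5_holds : Step_5` — Lemma 4.1, p. 2549: the ball averages `⨍_{B(x,r)} ⟪curl w, a⟫` converge to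
  the point value `⟪curl w(x), a⟫` as `r → 0⁺`, for smooth `w` (continuity of `curl w`; the
  elementary «Lebesgue point at a point of continuity» lemma `tendsto_setAverage_ball_of_continuous`
  is proved here for `ℝ³`).
* `lemma42_round` — the referee's ONE charitable re-typing of the failing step (`ns-claims-ref-1`,
  `RETYPE.md` R#3, Prop `RefOneScratch.Kyritsis2022.Step6Round`, token-for-token): Lemma 4.2 for
  ROUND balls (the author's own caveat, p. 2550 l. 2–5) — the volume average of `⟪curl w, a⟫` over
  `B(x, r)` is at most `sup ‖curl w‖` for a unit axis `a`. TRUE (proved here: `|⨍ φ| ≤ sup |φ|`); it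
  is the `Φ = Ψ = id` instance of the typed `Step_6` (`step6_id`), and it does NOT rescue the
  argument (RETYPE.md: the material composition consumes `Step_6` at `Φ = Y t`; the literal one needs
  the false `Step_10`).
* `Step_2` needs nothing: it IS the tree fact
  `lintegral_iSup_curl_eq_top_of_not_hasSobolevExtensionPast`, discharged in
  `NSVorticityBKMHolds.lean`. `Step_1` / `Step_12` (local theory package) are classical
  (Majda–Bertozzi Thm 3.4, Cor. 3.2; tree `MajdaBertozzi2002_localExistenceH3_holds`,
  `particleTrajectoryMap`) and are tabled «classical + cite», not re-derived here.

Solo lane (`Theorems/SoloSalvage<Slug>.lean`, no item; DIRECTOR-NS 17:01:06Z / lead 17:51:28Z).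

WHAT THIS IS NOT: not a claim about NS regularity or blow-up; not a claim about any author beyond the
typed locator.
-/

noncomputable section

-- The summit-side namespace `Summit.NavierStokesRegularity.NavierStokesRegularity.Theorems` repeats
-- the summit name by design (D-0017 layout); the duplicate-namespace linter is silenced for it
-- (tree precedent: `SoloSalvageRamm2024.lean`, `SoloRefuteKyritsis2022.lean`).
set_option linter.dupNamespace false

open MeasureTheory Set Filter Metric
open scoped RealInnerProductSpace Topology ContDiff

namespace Summit.NavierStokesRegularity.NavierStokesRegularity.Theorems.Kyritsis2022Salvage

open Literature.Analysis.FluidPDE Literature.Claims.NS.Kyritsis2022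

/-! ## Two elementary measure-theoretic lemmas on ball averages in `ℝ³` -/

/-- **Averages over small balls of a continuous function converge to the point value**
(every point is a Lebesgue point of a continuous function): for `φ : ℝ³ → ℝ` continuous and any
`x`, `⨍_{B(x,r)} φ → φ(x)` as `r → 0⁺`. Proof: for `r < δ(ε)`,
`|⨍_{B} φ − φ(x)| = |B|⁻¹ |∫_B (φ − φ(x))| ≤ ε`. -/
theorem tendsto_setAverage_ball_of_continuous {φ : EuclideanSpace ℝ (Fin 3) → ℝ}
    (hφ : Continuous φ) (x : EuclideanSpace ℝ (Fin 3)) :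
    Tendsto (fun r : ℝ => ⨍ y in ball x r, φ y) (𝓝[>] 0) (𝓝 (φ x)) := by
  rw [Metric.tendsto_nhdsWithin_nhds]
  intro ε hε
  obtain ⟨δ, hδ, hball⟩ := Metric.continuous_iff.mp hφ x (ε / 2) (half_pos hε)
  refine ⟨δ, hδ, fun {r} hr hrδ => ?_⟩
  have hr0 : 0 < r := hr
  have hrδ' : r < δ := by
    rw [Real.dist_eq, sub_zero, abs_of_pos hr0] at hrδ
    exact hrδ
  have hμpos : 0 < volume.real (ball x r) := by
    rw [measureReal_def]
    exact ENNReal.toReal_pos (measure_ball_pos volume x hr0).ne' measure_ball_lt_top.ne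
  have hK : IsCompact (closedBall x r) := isCompact_closedBall x r
  have hint : IntegrableOn φ (ball x r) volume :=
    (hφ.continuousOn.integrableOn_compact hK).mono_set ball_subset_closedBall
  have hintc : IntegrableOn (fun _ => φ x) (ball x r) volume :=
    (continuous_const.continuousOn.integrableOn_compact hK).mono_set ball_subset_closedBall
  have hbound : ∀ y ∈ ball x r, ‖φ y - φ x‖ ≤ ε / 2 := by
    intro y hy
    have h := (hball y ((mem_ball.mp hy).trans hrδ')).le
    rwa [Real.dist_eq, ← Real.norm_eq_abs] at h
  have hI : ‖∫ y in ball x r, (φ y - φ x)‖ ≤ ε / 2 * volume.real (ball x r) :=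
    norm_setIntegral_le_of_norm_le_const measure_ball_lt_top hbound
  have hsub : ∫ y in ball x r, (φ y - φ x) =
      (∫ y in ball x r, φ y) - volume.real (ball x r) • φ x := by
    rw [integral_sub hint hintc, setIntegral_const]
  have hkey : (volume.real (ball x r))⁻¹ • (∫ y in ball x r, φ y) - φ x =
      (volume.real (ball x r))⁻¹ • ∫ y in ball x r, (φ y - φ x) := by
    rw [hsub, smul_sub, smul_smul, inv_mul_cancel₀ hμpos.ne', one_smul]
  rw [Real.dist_eq, setAverage_eq, hkey, smul_eq_mul, abs_mul, abs_inv, abs_of_pos hμpos,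
    ← Real.norm_eq_abs]
  calc (volume.real (ball x r))⁻¹ * ‖∫ y in ball x r, (φ y - φ x)‖
      ≤ (volume.real (ball x r))⁻¹ * (ε / 2 * volume.real (ball x r)) := by gcongr
    _ = ε / 2 := by field_simp
    _ < ε := half_lt_self hε

/-- **The average of a function bounded in absolute value by `M` over a ball of positive radius is
at most `M`**: `⨍_{B(x,r)} φ ≤ M` whenever `|φ| ≤ M` on `ℝ³` (no integrability hypothesis: a
non-integrable `φ` has average `0 ≤ M`). -/
theorem setAverage_ball_le_of_abs_le {φ : EuclideanSpace ℝ (Fin 3) → ℝ} {M : ℝ}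
    (hM : ∀ y, |φ y| ≤ M) (x : EuclideanSpace ℝ (Fin 3)) {r : ℝ} (hr : 0 < r) :
    ⨍ y in ball x r, φ y ≤ M := by
  have hμpos : 0 < volume.real (ball x r) := by
    rw [measureReal_def]
    exact ENNReal.toReal_pos (measure_ball_pos volume x hr).ne' measure_ball_lt_top.ne
  have hI : ‖∫ y in ball x r, φ y‖ ≤ M * volume.real (ball x r) :=
    norm_setIntegral_le_of_norm_le_const measure_ball_lt_top fun y _ => by
      rw [Real.norm_eq_abs]
      exact hM y
  rw [setAverage_eq, smul_eq_mul]
  calc (volume.real (ball x r))⁻¹ * ∫ y in ball x r, φ y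
      ≤ (volume.real (ball x r))⁻¹ * ‖∫ y in ball x r, φ y‖ := by
        gcongr
        exact Real.le_norm_self _
    _ ≤ (volume.real (ball x r))⁻¹ * (M * volume.real (ball x r)) := by gcongr
    _ = M := by field_simp

/-! ## Step 3 (Remark 2.1, p. 2541): Clay decay gives bounded initial vorticity -/

/-- **`Step_3` holds** (Remark 2.1, p. 2541: «smooth Schwartz initial velocities after (2.4) will
give that the initial vorticity ω₀ = curl(u₀), in its supremum norm, is bounded over all 3-space»):
the decay hypothesis (2.4) = Fefferman's (4) with `n = 1`, `K = 0` bounds `‖Du₀(x)‖ = ‖D¹u₀(x)‖`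
uniformly, and `‖curl u₀(x)‖ ≤ ‖curlCLM‖ · ‖Du₀(x)‖`. -/
theorem step3_holds : Step_3 := by
  intro u₀ _ hdecay
  obtain ⟨C, hC⟩ := hdecay 1 0
  refine ⟨‖curlCLM‖ * C, ?_⟩
  rintro _ ⟨y, rfl⟩
  have h1 : ‖iteratedFDeriv ℝ 1 u₀ y‖ ≤ C := by simpa using hC y
  calc ‖curl u₀ y‖ ≤ ‖curlCLM‖ * ‖fderiv ℝ u₀ y‖ := norm_curl_le u₀ y
    _ = ‖curlCLM‖ * ‖iteratedFDeriv ℝ 1 u₀ y‖ := by rw [norm_iteratedFDeriv_one]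
    _ ≤ ‖curlCLM‖ * C := by gcongr

/-! ## Step 5 (Lemma 4.1, p. 2549): ball averages of the vorticity converge to the point value -/

/-- The vorticity of a `C^∞` field is continuous (`curl w = curlCLM ∘ Dw`). -/
theorem continuous_curl_of_contDiff {w : EuclideanSpace ℝ (Fin 3) → EuclideanSpace ℝ (Fin 3)}
    (hw : ContDiff ℝ ∞ w) : Continuous (curl w) := by
  rw [curl_eq_curlCLM_comp]
  exact curlCLM.continuous.comp (hw.continuous_fderiv (by simp))

/-- **`Step_5` holds** (Lemma 4.1, p. 2549: «by taking the limit of shrinking the ball to its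
center x (r → 0), the average vorticity ω_B converges to the point vorticity … [or] to the
projection component ωₐ(x) of the point vorticity on the axis a»): for smooth `w`, any axis `a`
and centre `x`, `⨍_{B(x,r)} ⟪curl w, a⟫ → ⟪curl w(x), a⟫` as `r → 0⁺` — every point is a Lebesgue
point of the continuous function `⟪curl w(·), a⟫`. -/
theorem step5_holds : Step_5 := by
  intro w hw a x
  have hcont : Continuous fun y => ⟪curl w y, a⟫ :=
    (continuous_curl_of_contDiff hw).inner continuous_const
  exact tendsto_setAverage_ball_of_continuous hcont x

/-! ## The referee's charitable re-typing of the failing Step 6 (Lemma 4.2 for ROUND balls) is true -/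

/-- **Lemma 4.2 (4.3), p. 2550, for round balls — the referee's charitable re-typing, TRUE.** This
is, token for token, `RefOneScratch.Kyritsis2022.Step6Round` of `ns-claims-ref-1`'s
`retype-Kyritsis2022.lean` (RETYPE.md R#3; the author's own caveat p. 2550 l. 2–5: «Lemma 4.2 holds
not on arbitrary 3D shapes … only when we start with standard 3D shapes like a sphere»): for every
smooth divergence-free `w` with bounded vorticity, unit axis `a`, centre `x`, radius `r > 0`, the
volume average `⨍_{B(x,r)} ⟪curl w, a⟫` is at most `sup_y ‖curl w(y)‖` (Cauchy–Schwarz pointwise,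
then `|⨍ φ| ≤ sup |φ|`). (The smoothness and divergence hypotheses are not used.) It does not
rescue the argument: the composition of Thm 4.4 consumes `Step_6` at the flow preimage
`Φ = Y t`, where it is false (`SoloRefuteKyritsis2022.lean`, `not_Step_6`). -/
theorem lemma42_round :
    ∀ w : EuclideanSpace ℝ (Fin 3) → EuclideanSpace ℝ (Fin 3), ContDiff ℝ ∞ w →
      VectorCalculus.IsDivFree w → BddAbove (Set.range fun y => ‖curl w y‖) →
      ∀ a : EuclideanSpace ℝ (Fin 3), ‖a‖ = 1 → ∀ x : EuclideanSpace ℝ (Fin 3), ∀ r : ℝ, 0 < r →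
        ballAvg (curl w) a x r ≤ ⨆ y, ‖curl w y‖ := by
  intro w _ _ hb a ha x r hr
  unfold ballAvg
  refine setAverage_ball_le_of_abs_le (fun y => ?_) x hr
  calc |⟪curl w y, a⟫| ≤ ‖curl w y‖ * ‖a‖ := abs_real_inner_le_norm _ _
    _ = ‖curl w y‖ := by rw [ha, mul_one]
    _ ≤ ⨆ z, ‖curl w z‖ := le_ciSup hb y

/-- The `Φ = Ψ = id` instance of the typed `Step_6` (the printed Lemma 4.2 applied to the round ball
itself) is true — the one instance the printed proof («∫₀^π ∬_S ds dθ = |B|») actually covers,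
p. 2550. -/
theorem step6_id :
    ∀ w : EuclideanSpace ℝ (Fin 3) → EuclideanSpace ℝ (Fin 3), ContDiff ℝ ∞ w →
      VectorCalculus.IsDivFree w → BddAbove (Set.range fun y => ‖curl w y‖) →
      ∀ a : EuclideanSpace ℝ (Fin 3), ‖a‖ = 1 → ∀ x : EuclideanSpace ℝ (Fin 3), ∀ r : ℝ, 0 < r →
        imageFluxAvg (curl w) id id a x r ≤ ⨆ y, ‖curl w y‖ := by
  intro w hw hdiv hb a ha x r hr
  rw [imageFluxAvg_id]
  exact lemma42_round w hw hdiv hb a ha x r hr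

end Summit.NavierStokesRegularity.NavierStokesRegularity.Theorems.Kyritsis2022Salvage
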